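import Summits.ValiantsHypothesis.ValiantsHypothesis.Theorems.LacunarySymmetroidMatrixDescartesPivotRankOneFourKillSeven

/-!
# `MatrixDescartes` census — the `(2,4)₁` cell with RANK-ONE letters: the companion condition (S′) for `Z₊ ≤ 8`
# (second kept four-set of the kill-seven argument; with (S) it covered every located chamber-(B) sample with generic letters)

HONEST FRAMING.  Object-search cell `pub-symmetroid`, seat `val-sym-mdr-p1` (generation 12); helper file `--supports` the crux item
stmt-ValiantsHypothesis-18050 (`Theses.LacunarySymmetroid.MatrixDescartes`, OPEN, on HOLD) with NO closure claim.  Companion of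
`…PivotRankOneFourKillSeven` (condition (S); engine `…PivotTwoDirectionsBlockLaw`).

**THEOREM (`rankOne_posRoots_le_eight_of_condSprime`, real-parameter form `elevenNomial_condSprime_le_eight`).**  For the rank-one
pencil `F = X^e J + ∑ₖ wₖ X^{dₖ} vₖvₖᵀ` (`d₀ < d₁ < e < d₂ < d₃`, `w₀, w₁, w₃ > 0`, `J` arbitrary, letter `1` pairing negatively with
`J`, `v₁ ∦ v₃`) with `d₀ + d₂ < e + d₁` and `e + d₂ < d₁ + d₃` (both hold in chamber (B)), the angular condition (S′)
`|m(J,v₁)|·Δ₀₃²·Π′(e+d₁)·Π′(d₀+d₃) ≤ |m(J,v₀)|·Δ₁₃²·Π′(e+d₀)·Π′(d₁+d₃)` (distance products to the killed degrees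
`2e, e+d₂, e+d₃, d₀+d₁, d₀+d₂, d₁+d₂, d₂+d₃`, spelled out) gives `Z₊ ≤ 8`: the survivors `e+d₀ < e+d₁ < d₀+d₃ < d₁+d₃` are two
translated pairs (shift `d₃ − e`), the killed eleven-nomial is minus `A X^{e+d₀} − B X^{e+d₁} + C X^{d₀+d₃} − D X^{d₁+d₃}`, and (S′) is
its cross-ratio hypothesis.  (S′) fails only when letter `0` is nearly non-core or letters `1, 3` nearly parallel — complementary to
(S) (letter `3` nearly non-core or letters `0, 1` nearly parallel).

LOCATED, NOT CLAIMED (exp/gen24b.py, sound analytic classifier): over 1 500 chamber-(B) samples with letters at generic and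
near-boundary angles, every sample satisfied (S) or (S′); with letters `0` AND `3` both nearly non-core neither need hold, and the kept
sets `{e+d₁, d₁+d₂, e+d₃, d₂+d₃}` / the all-pair sets take over (600/600 located) — those theorems are not written.  The rank-one law
`(2,4)₁ ≤ 8` is NOT claimed.  Nothing here bears on `MatrixDescartes` in its window, on `DoorA26` / `DoorA34`, registers / credences,
or `VP ≠ VNP`.

[folklore] As in the companion.  No definitions, no named facts.
-/

-- `Summit.ValiantsHypothesis.ValiantsHypothesis.…` repeats a component by the D-0017 layout
-- (single-conjunct summit), which the `dupNamespace` linter flags; the name is mandated.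
set_option linter.dupNamespace false

namespace Summit.ValiantsHypothesis.ValiantsHypothesis.Theorems.LacunarySymmetroidMatrixDescartes.Pivot.TwoDirections.BlockLaw

open Polynomial Matrix Finset
open scoped BigOperators

/-- **The eleven-nomial under `d₀ + d₂ < e + d₁`, `e + d₂ < d₁ + d₃` and condition (S′) has at most eight positive roots**
(kept set `{e+d₀, e+d₁, d₀+d₃, d₁+d₃}`, killed `2e, e+d₂, e+d₃, d₀+d₁, d₀+d₂, d₁+d₂, d₂+d₃`; `m₁ < 0`, `D13 > 0`, `w₀, w₁, w₃ > 0`; (S′):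
`|m₁|·D03·Π′(e+d₁)·Π′(d₀+d₃) ≤ |m₀|·D13·Π′(e+d₀)·Π′(d₁+d₃)`). -/
theorem elevenNomial_condSprime_le_eight (e d₀ d₁ d₂ d₃ : ℕ) (h01 : d₀ < d₁) (h1e : d₁ < e) (he2 : e < d₂) (h23 : d₂ < d₃)
    (hB1 : d₀ + d₂ < e + d₁) (hB3 : e + d₂ < d₁ + d₃)
    (dJ m₀ m₁ m₂ m₃ w₀ w₁ w₂ w₃ D01 D02 D03 D12 D13 D23 : ℝ) (hw₀ : 0 < w₀) (hw₁ : 0 < w₁) (hw₃ : 0 < w₃)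
    (hm₁ : m₁ < 0) (hD13 : 0 < D13)
    (hS : (-m₁) * D03
        * (((e : ℝ) - d₁) * ((d₂ : ℝ) - d₁) * ((d₃ : ℝ) - d₁) * ((e : ℝ) - d₀) * ((e : ℝ) + d₁ - d₀ - d₂) * ((d₂ : ℝ) - e) * ((d₂ : ℝ) + d₃ - e - d₁))
        * (((d₀ : ℝ) + d₃ - 2 * e) * ((e : ℝ) + d₂ - d₀ - d₃) * ((e : ℝ) - d₀) * ((d₃ : ℝ) - d₁) * ((d₃ : ℝ) - d₂) * ((d₀ : ℝ) + d₃ - d₁ - d₂) * ((d₂ : ℝ) - d₀))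
        ≤ (-m₀) * D13
        * (((e : ℝ) - d₀) * ((d₂ : ℝ) - d₀) * ((d₃ : ℝ) - d₀) * ((e : ℝ) - d₁) * ((d₂ : ℝ) - e) * ((d₁ : ℝ) + d₂ - e - d₀) * ((d₂ : ℝ) + d₃ - e - d₀))
        * (((d₁ : ℝ) + d₃ - 2 * e) * ((d₁ : ℝ) + d₃ - e - d₂) * ((e : ℝ) - d₁) * ((d₃ : ℝ) - d₀) * ((d₁ : ℝ) + d₃ - d₀ - d₂) * ((d₃ : ℝ) - d₂) * ((d₂ : ℝ) - d₁))) :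
    ((∑ i : Fin 11, Polynomial.C ((![dJ, w₀ * m₀, w₁ * m₁, w₂ * m₂, w₃ * m₃, w₀ * w₁ * D01, w₀ * w₂ * D02, w₀ * w₃ * D03, w₁ * w₂ * D12, w₁ * w₃ * D13, w₂ * w₃ * D23] : Fin 11 → ℝ) i) * X ^ ((![2 * e, e + d₀, e + d₁, e + d₂, e + d₃, d₀ + d₁, d₀ + d₂, d₀ + d₃, d₁ + d₂, d₁ + d₃, d₂ + d₃] : Fin 11 → ℕ) i)).roots.toFinset.filter (fun t => 0 < t)).card ≤ 8 := by
  classical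
  have h01' : (d₀ : ℝ) < d₁ := by exact_mod_cast h01
  have h1e' : (d₁ : ℝ) < e := by exact_mod_cast h1e
  have he2' : (e : ℝ) < d₂ := by exact_mod_cast he2
  have h23' : (d₂ : ℝ) < d₃ := by exact_mod_cast h23
  have hB1' : (d₀ : ℝ) + d₂ < e + d₁ := by exact_mod_cast hB1
  have hB3' : (e : ℝ) + d₂ < d₁ + d₃ := by exact_mod_cast hB3
  -- the four distance products (positive atoms)
  obtain ⟨PA, hPA⟩ : ∃ x : ℝ, x = ((e : ℝ) - d₀) * ((d₂ : ℝ) - d₀) * ((d₃ : ℝ) - d₀) * ((e : ℝ) - d₁) * ((d₂ : ℝ) - e) * ((d₁ : ℝ) + d₂ - e - d₀) * ((d₂ : ℝ) + d₃ - e - d₀) := ⟨_, rfl⟩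
  obtain ⟨PB, hPB⟩ : ∃ x : ℝ, x = ((e : ℝ) - d₁) * ((d₂ : ℝ) - d₁) * ((d₃ : ℝ) - d₁) * ((e : ℝ) - d₀) * ((e : ℝ) + d₁ - d₀ - d₂) * ((d₂ : ℝ) - e) * ((d₂ : ℝ) + d₃ - e - d₁) := ⟨_, rfl⟩
  obtain ⟨PC, hPC⟩ : ∃ x : ℝ, x = ((d₀ : ℝ) + d₃ - 2 * e) * ((e : ℝ) + d₂ - d₀ - d₃) * ((e : ℝ) - d₀) * ((d₃ : ℝ) - d₁) * ((d₃ : ℝ) - d₂) * ((d₀ : ℝ) + d₃ - d₁ - d₂) * ((d₂ : ℝ) - d₀) := ⟨_, rfl⟩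
  obtain ⟨PD, hPD⟩ : ∃ x : ℝ, x = ((d₁ : ℝ) + d₃ - 2 * e) * ((d₁ : ℝ) + d₃ - e - d₂) * ((e : ℝ) - d₁) * ((d₃ : ℝ) - d₀) * ((d₁ : ℝ) + d₃ - d₀ - d₂) * ((d₃ : ℝ) - d₂) * ((d₂ : ℝ) - d₁) := ⟨_, rfl⟩
  have hS' : (-m₁) * D03 * PB * PC ≤ (-m₀) * D13 * PA * PD := by rw [hPA, hPB, hPC, hPD]; exact hS
  clear hS
  have hPBp : 0 < PB := by
    rw [hPB]
    have f1 : 0 < (e : ℝ) - d₁ := by linarith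
    have f2 : 0 < (d₂ : ℝ) - d₁ := by linarith
    have f3 : 0 < (d₃ : ℝ) - d₁ := by linarith
    have f4 : 0 < (e : ℝ) - d₀ := by linarith
    have f5 : 0 < (e : ℝ) + d₁ - d₀ - d₂ := by linarith
    have f6 : 0 < (d₂ : ℝ) - e := by linarith
    have f7 : 0 < (d₂ : ℝ) + d₃ - e - d₁ := by linarith
    exact mul_pos (mul_pos (mul_pos (mul_pos (mul_pos (mul_pos f1 f2) f3) f4) f5) f6) f7
  have hPDp : 0 < PD := by
    rw [hPD]
    have f1 : 0 < (d₁ : ℝ) + d₃ - 2 * e := by linarith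
    have f2 : 0 < (d₁ : ℝ) + d₃ - e - d₂ := by linarith
    have f3 : 0 < (e : ℝ) - d₁ := by linarith
    have f4 : 0 < (d₃ : ℝ) - d₀ := by linarith
    have f5 : 0 < (d₁ : ℝ) + d₃ - d₀ - d₂ := by linarith
    have f6 : 0 < (d₃ : ℝ) - d₂ := by linarith
    have f7 : 0 < (d₂ : ℝ) - d₁ := by linarith
    exact mul_pos (mul_pos (mul_pos (mul_pos (mul_pos (mul_pos f1 f2) f3) f4) f5) f6) f7
  -- the four surviving coefficients
  obtain ⟨A, hA⟩ : ∃ x : ℝ, x = w₀ * (-m₀) * PA := ⟨_, rfl⟩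
  obtain ⟨B, hB⟩ : ∃ x : ℝ, x = w₁ * (-m₁) * PB := ⟨_, rfl⟩
  obtain ⟨C, hC⟩ : ∃ x : ℝ, x = w₀ * w₃ * D03 * PC := ⟨_, rfl⟩
  obtain ⟨D, hD⟩ : ∃ x : ℝ, x = w₁ * w₃ * D13 * PD := ⟨_, rfl⟩
  have hBp : 0 < B := by rw [hB]; exact mul_pos (mul_pos hw₁ (by linarith)) hPBp
  have hDp : 0 < D := by rw [hD]; exact mul_pos (mul_pos (mul_pos hw₁ hw₃) hD13) hPDp
  have hBC : B * C ≤ A * D := by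
    have e1 : B * C = (w₀ * w₁ * w₃) * ((-m₁) * D03 * PB * PC) := by rw [hB, hC]; ring
    have e2 : A * D = (w₀ * w₁ * w₃) * ((-m₀) * D13 * PA * PD) := by rw [hA, hD]; ring
    rw [e1, e2]
    exact mul_le_mul_of_nonneg_left hS' (mul_pos (mul_pos hw₀ hw₁) hw₃).le
  -- seven kills
  have hkills := card_posRoots_le_kills (Finset.univ : Finset (Fin 11)) (![2 * e, e + d₀, e + d₁, e + d₂, e + d₃, d₀ + d₁, d₀ + d₂, d₀ + d₃, d₁ + d₂, d₁ + d₃, d₂ + d₃] : Fin 11 → ℕ) [2 * e, e + d₂, e + d₃, d₀ + d₁, d₀ + d₂, d₁ + d₂, d₂ + d₃] (![dJ, w₀ * m₀, w₁ * m₁, w₂ * m₂, w₃ * m₃, w₀ * w₁ * D01, w₀ * w₂ * D02, w₀ * w₃ * D03, w₁ * w₂ * D12, w₁ * w₃ * D13, w₂ * w₃ * D23] : Fin 11 → ℝ)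
  -- the killed eleven-nomial is MINUS the four-nomial `A X^{d₀+d₁} − B X^{e+d₁} + C X^{d₀+d₃} − D X^{e+d₃}`
  have hfour : (∑ i ∈ (Finset.univ : Finset (Fin 11)), Polynomial.C ((![dJ, w₀ * m₀, w₁ * m₁, w₂ * m₂, w₃ * m₃, w₀ * w₁ * D01, w₀ * w₂ * D02, w₀ * w₃ * D03, w₁ * w₂ * D12, w₁ * w₃ * D13, w₂ * w₃ * D23] : Fin 11 → ℝ) i
          * (([2 * e, e + d₂, e + d₃, d₀ + d₁, d₀ + d₂, d₁ + d₂, d₂ + d₃]).map (fun ρ : ℕ => ((((![2 * e, e + d₀, e + d₁, e + d₂, e + d₃, d₀ + d₁, d₀ + d₂, d₀ + d₃, d₁ + d₂, d₁ + d₃, d₂ + d₃] : Fin 11 → ℕ) i : ℕ) : ℝ) - (ρ : ℝ)))).prod) * X ^ ((![2 * e, e + d₀, e + d₁, e + d₂, e + d₃, d₀ + d₁, d₀ + d₂, d₀ + d₃, d₁ + d₂, d₁ + d₃, d₂ + d₃] : Fin 11 → ℕ) i))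
      = -(Polynomial.C A * X ^ (e + d₀) - Polynomial.C B * X ^ (e + d₀ + (d₁ - d₀))
          + Polynomial.C C * X ^ (e + d₀ + (d₃ - e)) - Polynomial.C D * X ^ (e + d₀ + (d₁ - d₀) + (d₃ - e))) := by
    have e3 : e + d₀ + (d₁ - d₀) + (d₃ - e) = d₁ + d₃ := by omega
    have e1 : e + d₀ + (d₁ - d₀) = e + d₁ := by omega
    have e2 : e + d₀ + (d₃ - e) = d₀ + d₃ := by omega
    rw [e3, e1, e2]
    have hcoef : ∀ i : Fin 11, (![dJ, w₀ * m₀, w₁ * m₁, w₂ * m₂, w₃ * m₃, w₀ * w₁ * D01, w₀ * w₂ * D02, w₀ * w₃ * D03, w₁ * w₂ * D12, w₁ * w₃ * D13, w₂ * w₃ * D23] : Fin 11 → ℝ) i * (([2 * e, e + d₂, e + d₃, d₀ + d₁, d₀ + d₂, d₁ + d₂, d₂ + d₃]).map (fun ρ : ℕ => ((((![2 * e, e + d₀, e + d₁, e + d₂, e + d₃, d₀ + d₁, d₀ + d₂, d₀ + d₃, d₁ + d₂, d₁ + d₃, d₂ + d₃] : Fin 11 → ℕ) i : ℕ) : ℝ)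 - (ρ : ℝ)))).prod
        = (![0, -A, B, 0, 0, 0, 0, -C, 0, D, 0] : Fin 11 → ℝ) i := by
      intro i
      fin_cases i <;>
        simp only [Fin.zero_eta, Fin.mk_one, Fin.isValue, Matrix.cons_val_zero, Matrix.cons_val_one,
          List.map_cons, List.map_nil, List.prod_cons, List.prod_nil, hA, hB, hC, hD, hPA, hPB, hPC, hPD] <;>
        push_cast <;> ring
    rw [Finset.sum_congr rfl (fun i _ => by rw [hcoef i])]
    simp only [Fin.sum_univ_succ, Fin.sum_univ_zero, Matrix.cons_val_zero, Matrix.cons_val_succ, map_zero, zero_mul,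
      zero_add, add_zero, Polynomial.C_neg]
    ring
  rw [hfour, Polynomial.roots_neg] at hkills
  have hone := card_posRoots_fourNomial_le_one A B C D hBp hDp hBC (e + d₀) (d₁ - d₀) (d₃ - e) (by omega)
  simp only [List.length_cons, List.length_nil] at hkills
  omega

/-- **RANK-ONE `(2,4)₁` WITH `d₀ + d₂ < e + d₁`, `e + d₂ < d₁ + d₃` (e.g. chamber (B)): `Z₊ ≤ 8` under the companion condition (S′)**
(matrix form; `J` arbitrary; letter `1` pairing negatively with `J`, `v₁ ∦ v₃`; see the module docstring). [this file] -/
theorem rankOne_posRoots_le_eight_of_condSprime (e d₀ d₁ d₂ d₃ : ℕ) (h01 : d₀ < d₁) (h1e : d₁ < e) (he2 : e < d₂) (h23 : d₂ < d₃)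
    (hB1 : d₀ + d₂ < e + d₁) (hB3 : e + d₂ < d₁ + d₃)
    (J : Matrix (Fin 2) (Fin 2) ℝ) (v₀ v₁ v₂ v₃ : Fin 2 → ℝ) (w₀ w₁ w₂ w₃ : ℝ) (hw₀ : 0 < w₀) (hw₁ : 0 < w₁) (hw₃ : 0 < w₃)
    (hm₁ : (J 0 0 * v₁ 1 ^ 2 + J 1 1 * v₁ 0 ^ 2 - (J 0 1 + J 1 0) * (v₁ 0 * v₁ 1)) < 0) (hΔ₁₃ : v₁ 0 * v₃ 1 - v₁ 1 * v₃ 0 ≠ 0)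
    (hS : (-(J 0 0 * v₁ 1 ^ 2 + J 1 1 * v₁ 0 ^ 2 - (J 0 1 + J 1 0) * (v₁ 0 * v₁ 1))) * ((v₀ 0 * v₃ 1 - v₀ 1 * v₃ 0) ^ 2)
        * (((e : ℝ) - d₁) * ((d₂ : ℝ) - d₁) * ((d₃ : ℝ) - d₁) * ((e : ℝ) - d₀) * ((e : ℝ) + d₁ - d₀ - d₂) * ((d₂ : ℝ) - e) * ((d₂ : ℝ) + d₃ - e - d₁))
        * (((d₀ : ℝ) + d₃ - 2 * e) * ((e : ℝ) + d₂ - d₀ - d₃) * ((e : ℝ) - d₀) * ((d₃ : ℝ) - d₁) * ((d₃ : ℝ) - d₂) * ((d₀ : ℝ) + d₃ - d₁ - d₂) * ((d₂ : ℝ) - d₀))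
        ≤ (-(J 0 0 * v₀ 1 ^ 2 + J 1 1 * v₀ 0 ^ 2 - (J 0 1 + J 1 0) * (v₀ 0 * v₀ 1))) * ((v₁ 0 * v₃ 1 - v₁ 1 * v₃ 0) ^ 2)
        * (((e : ℝ) - d₀) * ((d₂ : ℝ) - d₀) * ((d₃ : ℝ) - d₀) * ((e : ℝ) - d₁) * ((d₂ : ℝ) - e) * ((d₁ : ℝ) + d₂ - e - d₀) * ((d₂ : ℝ) + d₃ - e - d₀))
        * (((d₁ : ℝ) + d₃ - 2 * e) * ((d₁ : ℝ) + d₃ - e - d₂) * ((e : ℝ) - d₁) * ((d₃ : ℝ) - d₀) * ((d₁ : ℝ) + d₃ - d₀ - d₂) * ((d₃ : ℝ) - d₂) * ((d₂ : ℝ) - d₁))) :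
    ((Matrix.det (((X : ℝ[X]) ^ e) • J.map Polynomial.C
        + (Polynomial.C w₀ * X ^ d₀) • (vecMulVec v₀ v₀).map Polynomial.C
        + (Polynomial.C w₁ * X ^ d₁) • (vecMulVec v₁ v₁).map Polynomial.C
        + (Polynomial.C w₂ * X ^ d₂) • (vecMulVec v₂ v₂).map Polynomial.C
        + (Polynomial.C w₃ * X ^ d₃) • (vecMulVec v₃ v₃).map Polynomial.C)).roots.toFinset.filter (fun t => 0 < t)).card
      ≤ 8 := by
  rw [det_rankOne_four_sum]
  exact elevenNomial_condSprime_le_eight e d₀ d₁ d₂ d₃ h01 h1e he2 h23 hB1 hB3 J.det _ _ _ _ w₀ w₁ w₂ w₃ _ _ _ _ _ _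
    hw₀ hw₁ hw₃ hm₁ (by positivity) hS

end Summit.ValiantsHypothesis.ValiantsHypothesis.Theorems.LacunarySymmetroidMatrixDescartes.Pivot.TwoDirections.BlockLaw
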